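import Literature.RepresentationTheory.BorelWallach2000.U11ContragredientUniserial
import Literature.Algebra.Module.LocalColocalModules
import Literature.Algebra.Module.Waists
import HarnessLib

/-!
# The contragredient of an admissible `(𝔤, K)`-module of `U(1,1)` is indecomposable iff the module is; «colocal ⟷ local» under `M ↦ M~`;
# `P(s, λ)` and `P(s, λ)~` are indecomposable (Borel–Wallach 0 §2.5; Bump §2.5 p. 200, Thm. 2.5.3; Anderson–Fuller §32)

Family `hodge`, lane `lit-hodgefound` (foundations library; seat `lit-hodgefound-p39`, generation 34, row g34-#11); topic
`RepresentationTheory/BorelWallach2000`, namespaces `…BorelWallach2000.U11DualFunctor` and `…U11PS` (continued).  Sequel of g34-#8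
(`U11ContragredientUniserial`: `M~` uniserial ⟺ `M` uniserial, `P(s, λ)~` uniserial), of g34-#10 (`Algebra/Module/LocalColocalModules`:
`indecomposable_iff_of_antiIso`, `isAtom_socle_iff_isCoatom_jacobson_of_antiIso`, `IsUniserial.indecomposable`), of g32-#10 (`annOrderIso :
Sub_R(M) ≃o Sub_R(M~)ᵒᵈ`, admissible `M`) and of g33-#15/#17 (`U11PrincipalSeriesLoewy` / `…Uniserial`: `soc P = W(a₂)`, `rad P = W(a₁)`, the only
atom / coatom of `Sub_R(P)`, `isUniserial_psMod`).
Borel–Wallach [BorelWallach2000, 0 §2.5]: for an admissible `(𝔤, K)`-module `V` the contragredient `Ṽ` is admissible and `V` is contragredient to `Ṽ`;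
`U ↦ U^⊥` is an anti-isomorphism of submodule lattices (g32-#10), and being a pair of complementary submodules is a self-dual lattice
condition, so **`M~` is indecomposable iff `M` is**; the anti-isomorphism carries `soc` to `rad` (g34-#0 `ann_socle`, `ann_jacobson`), so
**`soc(M~)` is a minimal submodule iff `rad M` is a maximal one** and dually («`M~` colocal ⟺ `M` local», Anderson–Fuller §32 p. 355, §9).
Bump [Bump1997, §2.5 p. 200]: the reducible principal series «is reducible, although it does not split into a direct sum» — in the tree's
operator-ring language **`P(s, λ)` is indecomposable for EVERY `s`, `λ`** (it is uniserial, g33-#17), and so is `P(s, λ)~`.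
INDECOMPOSABILITY is phrased as in the tree (`U11PrincipalSeriesWeightedIndecomposable`, `U11ExtensionsSplit`, `LocalColocalModules`):
`∀ A B : Submodule R M, IsCompl A B → A = ⊥ ∨ B = ⊥`.  Theorems only, 0 `sorry`, no definition, no named fact (net debt 0, D-0026), no instance,
no notation.

## What is formalised (`R = GKRing G11`, `M~ = GKDual.dualModule G11 hM`)

* §1 **`indecomposable_dualModule_iff`** (admissible `M`: `M~` indecomposable ⟺ `M` indecomposable), `indecomposable_dualModule`.
* §2 **`isAtom_socle_dualModule_iff`** (`soc(M~)` minimal ⟺ `rad M` maximal), **`isCoatom_jacobson_dualModule_iff`** (`rad(M~)` maximal ⟺ `soc M`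
  minimal) — the LATTICE companions of g34-#0's module-isomorphism statements `isSimpleModule_socle_dualModule_iff` / `isSimpleModule_top_dualModule_iff`.
* §3 **`U11PS.indecomposable_psMod`** (every `s`, `λ`), **`U11PS.indecomposable_dualModule_psMod`**, `isAtom_socle_dualModule_psMod`,
  `isCoatom_jacobson_dualModule_psMod`, `isSimpleModule_socle_dualModule_psMod`, `isSimpleModule_top_dualModule_psMod` (zeros `a₁ ≤ a₂`).
* §4 **`waist_ann_iff`** (`N^⊥` comparable with every submodule of `M~` ⟺ `N` comparable with every submodule of `M`; AGR Prop. 4 for the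
  contragredient duality), `waist_ann`.

v2 (row g34-#11a, same seat): §4 appended (imports g34-#13 `Algebra/Module/Waists`); §1–§3 unchanged byte-for-byte (v1 = p653347).

## Mathlib / Literature search

Tree: `U11PSW.indecomposable_of_lt/_of_le`, `bump_indecomposable_iff` (weighted / Bump models), `U11PS.not_isCompl_of_isGKSubmodule` (data language,
reducible `P(s, λ)`), `U11Ext.exists_forall_factor_of_indecomposable`; g32-#10 `annOrderIso`; g34-#0 `ann_socle`, `ann_jacobson`,
`isSimpleModule_socle_dualModule_iff`, `isSimpleModule_top_dualModule_iff` (REUSED in §3, not restated); g33-#15 `socle_psMod`, `jacobson_psMod`,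
`isAtom_iff_eq_upperR`, `isCoatom_iff_eq_upperR`, `isSimpleModule_socle_psMod`, `isSimpleModule_top_psMod`; g33-#17 `isUniserial_psMod`;
g34-#8 `isAdmissibleGK_psMod`, `isUniserial_dualModule_psMod`; g34-#10 `SocleRadical.indecomposable_iff_of_antiIso`, `indecomposable_of_antiIso`,
`isAtom_socle_iff_isCoatom_jacobson_of_antiIso`, `isCoatom_jacobson_iff_isAtom_socle_of_antiIso`, `IsUniserial.indecomposable`; Mathlib
`isSimpleModule_iff_isAtom`, `isSimpleModule_iff_isCoatom`.  `rg -n 'indecomposable_dualModule|indecomposable_psMod\\b'` → nothing in the tree.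

## References

* A. Borel, N. Wallach, *Continuous Cohomology, Discrete Subgroups, and Representations of Reductive Groups*, 2nd ed., AMS (2000), 0 §2.5, I §2.2.
  [BorelWallach2000]
* D. Bump, *Automorphic Forms and Representations*, CUP (1997), §2.5 p. 200, Thm. 2.5.3, Thm. 2.5.4. [Bump1997]
* F. W. Anderson, K. R. Fuller, *Rings and Categories of Modules*, 2nd ed., GTM 13 (1992), §32 (p. 355), §9 Prop. 9.7, Prop. 9.13. [AndersonFuller1992]
* H. Krause, *Homological Theory of Representations*, CUP (2021), Conventions (p. xxiv «Socle», «Radical»). [Krause2021]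
* M. Auslander, E. L. Green, I. Reiten, *Modules having waists*, in: Representations of Algebras (Ottawa 1974), LNM 488 (1975), 20–28: §1 (a),
  Prop. 4. [AuslanderGreenReiten1975]
-/

noncomputable section

open scoped Matrix ComplexConjugate
open Module

namespace Literature.RepresentationTheory.BorelWallach2000

open Literature.Algebra.Lie Literature.Algebra.Lie.ChevalleyEilenberg
open Literature.Algebra.Module
open Literature.NumberTheory.Automorphic
open Literature.RepresentationTheory.KonnoKonno2007 Literature.RepresentationTheory.KonnoKonno2007.RealDualPair
open Literature.RepresentationTheory.KonnoKonno2007.RealDualPair.UForm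
open Literature.LinearAlgebra
open U11HolDS

namespace U11DualFunctor

-- as in `U11ContragredientLoewy`: quotients of the contragredient over `GKRing G` need nested instance synthesis one level deeper than the default
set_option maxSynthPendingDepth 4

variable {M : Type*} [AddCommGroup M] [Module ℂ M] [Module (GKRing G11) M] [IsScalarTower ℂ (GKRing G11) M]
  (hM : IsGKModule G11 (GKRing.actK G11 M) (GKRing.actLie G11 M))

/-! ## §1 `M~` is indecomposable iff `M` is (admissible `M`) -/

/-- **The contragredient `M~` of an admissible `(𝔤, K)`-module `M` of `U(1,1)` is indecomposable iff `M` is**: `U ↦ U^⊥` is an anti-isomorphism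
`Sub_R(M) ≃o Sub_R(M~)ᵒᵈ` (g32-#10) and complementary pairs of submodules correspond under it (g34-#10 `indecomposable_iff_of_antiIso`).
[cite: BorelWallach2000, 0 §2.5, I §2.2] [cite: AndersonFuller1992, §32 (p. 355)] -/
theorem indecomposable_dualModule_iff (hadm : IsAdmissibleGK (GKRing.actK G11 M)) :
    (∀ A B : Submodule (GKRing G11) (GKDual.dualModule G11 hM), IsCompl A B → A = ⊥ ∨ B = ⊥) ↔
      ∀ A B : Submodule (GKRing G11) M, IsCompl A B → A = ⊥ ∨ B = ⊥ :=
  (SocleRadical.indecomposable_iff_of_antiIso (annOrderIso hM hadm)).symm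

/-- The contragredient of an indecomposable admissible module is indecomposable. [cite: BorelWallach2000, 0 §2.5, I §2.2]
[cite: AndersonFuller1992, §32 (p. 355)] -/
theorem indecomposable_dualModule (hadm : IsAdmissibleGK (GKRing.actK G11 M))
    (h : ∀ A B : Submodule (GKRing G11) M, IsCompl A B → A = ⊥ ∨ B = ⊥)
    (A B : Submodule (GKRing G11) (GKDual.dualModule G11 hM)) (hAB : IsCompl A B) : A = ⊥ ∨ B = ⊥ :=
  SocleRadical.indecomposable_of_antiIso (annOrderIso hM hadm) h A B hAB

/-! ## §2 «`M~` colocal ⟺ `M` local»: `soc(M~)` minimal ⟺ `rad M` maximal, `rad(M~)` maximal ⟺ `soc M` minimal -/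

/-- **`soc(M~)` is a minimal submodule iff `rad M` is a maximal submodule** (admissible `M`): `(rad M)^⊥ = soc(M~)` (g34-#0) and the
anti-isomorphism `U ↦ U^⊥` exchanges atoms and coatoms. [cite: BorelWallach2000, 0 §2.5, I §2.2] [cite: AndersonFuller1992, §9 Prop. 9.7, Prop. 9.13, §32 (p. 355)]
[cite: Krause2021, Conventions «Socle», «Radical»] -/
theorem isAtom_socle_dualModule_iff (hadm : IsAdmissibleGK (GKRing.actK G11 M)) :
    IsAtom (SocleRadical.socle (GKRing G11) (GKDual.dualModule G11 hM)) ↔ IsCoatom (Module.jacobson (GKRing G11) M) :=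
  (SocleRadical.isCoatom_jacobson_iff_isAtom_socle_of_antiIso (annOrderIso hM hadm)).symm

/-- **`rad(M~)` is a maximal submodule iff `soc M` is a minimal submodule** (admissible `M`): `(soc M)^⊥ = rad(M~)`.
[cite: BorelWallach2000, 0 §2.5, I §2.2] [cite: AndersonFuller1992, §9 Prop. 9.7, Prop. 9.13, §32 (p. 355)] [cite: Krause2021, Conventions «Socle», «Radical»] -/
theorem isCoatom_jacobson_dualModule_iff (hadm : IsAdmissibleGK (GKRing.actK G11 M)) :
    IsCoatom (Module.jacobson (GKRing G11) (GKDual.dualModule G11 hM)) ↔ IsAtom (SocleRadical.socle (GKRing G11) M) :=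
  (SocleRadical.isAtom_socle_iff_isCoatom_jacobson_of_antiIso (annOrderIso hM hadm)).symm

end U11DualFunctor

/-! ## §3 `P(s, λ)` and `P(s, λ)~` are indecomposable -/

namespace U11PS

-- quotients / socle subtypes of the contragredient over `GKRing G11` (as in §1–§2)
set_option maxSynthPendingDepth 4

variable {s : ℤ} {lam : ℂ}

/-- **`P(s, λ)` is indecomposable over the operator ring, for every `s`, `λ`**: it is uniserial (g33-#17 `isUniserial_psMod`), so of two
complementary submodules one is `0` — Bump's «reducible, although it does not split into a direct sum» (the tree's `not_isCompl_of_isGKSubmodule`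
is the data-language form for reducible parameters). [cite: Bump1997, §2.5 p. 200, Thm. 2.5.3] [cite: AndersonFuller1992, §32 (p. 355)] -/
theorem indecomposable_psMod (A B : Submodule (GKRing G11) (psMod s lam)) (hAB : IsCompl A B) : A = ⊥ ∨ B = ⊥ :=
  isUniserial_psMod.indecomposable A B hAB

/-- **The contragredient `P(s, λ)~` is indecomposable** (every `s`, `λ`; it is uniserial, g34-#8). [cite: BorelWallach2000, 0 §2.5, I §2.2]
[cite: Bump1997, §2.5 p. 200, Thm. 2.5.3] [cite: AndersonFuller1992, §32 (p. 355)] -/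
theorem indecomposable_dualModule_psMod (A B : Submodule (GKRing G11) (GKDual.dualModule G11 (U11TranslPS.isGKModule_psMod s lam)))
    (hAB : IsCompl A B) : A = ⊥ ∨ B = ⊥ :=
  isUniserial_dualModule_psMod.indecomposable A B hAB

/-- `soc(P~)` is a minimal submodule, for zeros `a₁ ≤ a₂` of `lc` (`rad P = W(a₁)` is the only maximal submodule of `P`, g33-#15).
[cite: Bump1997, Thm. 2.5.3 (ii)–(iii)] [cite: BorelWallach2000, 0 §2.5, I §2.2] [cite: Krause2021, Conventions «Socle», «Radical»] -/
theorem isAtom_socle_dualModule_psMod {a₁ a₂ : ℤ} (h₁ : lc s lam a₁ = 0) (h₂ : lc s lam a₂ = 0) (h₁₂ : a₁ + a₂ = s + 1) (hle : a₁ ≤ a₂) :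
    IsAtom (SocleRadical.socle (GKRing G11) (GKDual.dualModule G11 (U11TranslPS.isGKModule_psMod s lam))) := by
  rw [U11DualFunctor.isAtom_socle_dualModule_iff _ isAdmissibleGK_psMod, jacobson_psMod h₁ h₂ h₁₂ hle]
  exact (isCoatom_iff_eq_upperR h₁ h₂ h₁₂ hle _).mpr rfl

/-- `rad(P~)` is a maximal submodule, for zeros `a₁ ≤ a₂` (`soc P = W(a₂)` is the only minimal submodule of `P`, g33-#15).
[cite: Bump1997, Thm. 2.5.3 (ii)–(iii)] [cite: BorelWallach2000, 0 §2.5, I §2.2] [cite: Krause2021, Conventions «Socle», «Radical»] -/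
theorem isCoatom_jacobson_dualModule_psMod {a₁ a₂ : ℤ} (h₁ : lc s lam a₁ = 0) (h₂ : lc s lam a₂ = 0) (h₁₂ : a₁ + a₂ = s + 1) (hle : a₁ ≤ a₂) :
    IsCoatom (Module.jacobson (GKRing G11) (GKDual.dualModule G11 (U11TranslPS.isGKModule_psMod s lam))) := by
  rw [U11DualFunctor.isCoatom_jacobson_dualModule_iff _ isAdmissibleGK_psMod, socle_psMod h₁ h₂ h₁₂ hle]
  exact (isAtom_iff_eq_upperR h₁ h₂ h₁₂ hle _).mpr rfl

/-- The socle of `P~` is irreducible (zeros `a₁ ≤ a₂`). [cite: Bump1997, Thm. 2.5.3 (ii)–(iii)] [cite: BorelWallach2000, 0 §2.5, I §2.2]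
[cite: Krause2021, Conventions «Socle»] -/
theorem isSimpleModule_socle_dualModule_psMod {a₁ a₂ : ℤ} (h₁ : lc s lam a₁ = 0) (h₂ : lc s lam a₂ = 0) (h₁₂ : a₁ + a₂ = s + 1) (hle : a₁ ≤ a₂) :
    IsSimpleModule (GKRing G11) ↥(SocleRadical.socle (GKRing G11) (GKDual.dualModule G11 (U11TranslPS.isGKModule_psMod s lam))) :=
  (U11DualFunctor.isSimpleModule_socle_dualModule_iff _ isAdmissibleGK_psMod).mpr (isSimpleModule_top_psMod h₁ h₂ h₁₂ hle)

/-- The top `P~ ∕ rad(P~)` is irreducible (zeros `a₁ ≤ a₂`). [cite: Bump1997, Thm. 2.5.3 (ii)–(iii)] [cite: BorelWallach2000, 0 §2.5, I §2.2]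
[cite: Krause2021, Conventions «Radical»] -/
theorem isSimpleModule_top_dualModule_psMod {a₁ a₂ : ℤ} (h₁ : lc s lam a₁ = 0) (h₂ : lc s lam a₂ = 0) (h₁₂ : a₁ + a₂ = s + 1) (hle : a₁ ≤ a₂) :
    IsSimpleModule (GKRing G11) (GKDual.dualModule G11 (U11TranslPS.isGKModule_psMod s lam) ⧸
      Module.jacobson (GKRing G11) (GKDual.dualModule G11 (U11TranslPS.isGKModule_psMod s lam))) :=
  (U11DualFunctor.isSimpleModule_top_dualModule_iff _ isAdmissibleGK_psMod).mpr (isSimpleModule_socle_psMod h₁ h₂ h₁₂ hle)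

end U11PS

/-! ## §4 Waists under `M ↦ M~`: `N^⊥` is a waist of `M~` iff `N` is a waist of `M` (Auslander–Green–Reiten Prop. 4 for the contragredient) -/

namespace U11DualFunctor

variable {M : Type*} [AddCommGroup M] [Module ℂ M] [Module (GKRing G11) M] [IsScalarTower ℂ (GKRing G11) M]
  (hM : IsGKModule G11 (GKRing.actK G11 M) (GKRing.actLie G11 M))

/-- **`N^⊥` is comparable with every submodule of `M~` iff `N` is comparable with every submodule of `M`** (admissible `M`): the
contragredient instance of «`M′` is a waist in `M ⟺ D(M/M′)` is a waist in `D(M)`» — waists are self-dual under the anti-isomorphism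
`U ↦ U^⊥` (g32-#10 `annOrderIso`, g34-#13 `waist_iff_of_antiIso`). [cite: AuslanderGreenReiten1975, Prop. 4] [cite: BorelWallach2000, 0 §2.5, I §2.2] -/
theorem waist_ann_iff (hadm : IsAdmissibleGK (GKRing.actK G11 M)) (N : Submodule (GKRing G11) M) :
    (∀ K : Submodule (GKRing G11) (GKDual.dualModule G11 hM), K ≤ GKDual.ann G11 hM N ∨ GKDual.ann G11 hM N ≤ K) ↔
      ∀ K : Submodule (GKRing G11) M, K ≤ N ∨ N ≤ K := by
  rw [← annOrderIso_apply hM hadm]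
  exact (SocleRadical.waist_iff_of_antiIso (annOrderIso hM hadm) N).symm

/-- In particular **a module with a waist has a contragredient with a waist**: if `N ≠ 0, M` is comparable with every submodule of an
admissible `M`, then `N^⊥ ≠ 0, M~` is comparable with every submodule of `M~` (so `M~` is indecomposable, g34-#13 `indecomposable_of_waist`).
[cite: AuslanderGreenReiten1975, §1 (a), Prop. 4] [cite: BorelWallach2000, 0 §2.5, I §2.2] -/
theorem waist_ann (hadm : IsAdmissibleGK (GKRing.actK G11 M)) {N : Submodule (GKRing G11) M} (hbot : N ≠ ⊥) (htop : N ≠ ⊤)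
    (hN : ∀ K : Submodule (GKRing G11) M, K ≤ N ∨ N ≤ K) :
    GKDual.ann G11 hM N ≠ ⊥ ∧ GKDual.ann G11 hM N ≠ ⊤ ∧
      ∀ K : Submodule (GKRing G11) (GKDual.dualModule G11 hM), K ≤ GKDual.ann G11 hM N ∨ GKDual.ann G11 hM N ≤ K := by
  refine ⟨?_, ?_, (waist_ann_iff hM hadm N).mpr hN⟩
  · rw [ne_eq, ← GKDual.ann_top G11 hM, (ann_injective hM).eq_iff]
    exact htop
  · rw [ne_eq, ← GKDual.ann_bot G11 hM, (ann_injective hM).eq_iff]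
    exact hbot

end U11DualFunctor

end Literature.RepresentationTheory.BorelWallach2000
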